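import Summits.FinalStateConjecture.FinalStateConjecture.Theses.BartnikGapSettling
import Literature.Geometry.Lorentzian.BondiBartnikGap
import Literature.Geometry.Lorentzian.NearKerrCollarCore
import Literature.Geometry.Lorentzian.CollarMargin

/-!
# Crux `GapExhaustion` (stmt-FinalStateConjecture-10808) — line `Sketch`, lead skeleton

Route `BartnikGapSettling`, crux decl
`Summit.FinalStateConjecture.FinalStateConjecture.Theses.BartnikGapSettling.GapExhaustion`.
Line lead `prover-line-stmt-FinalStateConjecture-10808-0`, built from crux-idea card A
`omega-limit-gap-readout` (ideator 1, `Cruxes/GapExhaustion/SketchIdeator1.lean` §A).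

## Shape

The crux asks, for every admissible MGHD `𝒟` with complete `𝓘⁺` and a collar margin, for late
`(Λ,k)`-near-Kerr leaves carrying `N ≤ N₀` thick near-Kerr collars whose core `{p} ∪ ⋃ collars` has
a cut Bondi energy and Bondi–Bartnik gap `≤ γ`. The skeleton realises `N₀ = 1` with the probe point
INSIDE the collar (`N = 1`: core = the thick collar; `N = 0`: core = `{p}`), reads the filed text
through the `Iff.rfl` notions `CollarMargin`, `IsNearKerrLeaf`, `NearKerrCollarCore`,
`BondiBartnikGapLE` (`GapExhaustion_iff`), and closes the gap clause by
`bondiBartnikGapLE_of_forall_le` from two scalar bounds: an UPPER bound on one own cut energy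
(`m ≤ Σ Mᵢ + ε`, "no dark remainder") and a LOWER bound on every competitor mass.

## Stubs (sorries only here)

* `stub_lateCollaredLeaves` — card A (A) + the `N = 0` drain: late `Λ(k)`-bounded leaves with at most
  one `δ`-near-Kerr thick collar (closeness at any requested order `k'`), probe point in the collar;
  in the collar-free branch the probe point's cone has an energy `≤ ε`. (lead)
* `stub_singleCollarTightness` — card A (F)+(E)+mass loss, `ε`–`δ` form of "`Δ = 0`": uniformly in
  late enough, close enough single thick collars of the mass window, some own cut energy of the
  collar is `≤ M + ε`.
* `stub_kerrCollarMinimality` — card A (K) = route-review O1's KCM, verbatim the ideator's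
  `KerrCollarMinimalityQuant`: competitor masses of a `δ`-near-Kerr thick collar are `≥ M − ε`.
* `stub_pointConeEnergyNonneg` — positivity of the Bondi energy of point-cone cuts in MGHDs of
  admissible data (the `N = 0` competitor bound).

`GapExhaustion_of` is the sorry-free composition.
-/

noncomputable section

-- D-0017: single-problem summit, `Summit.<S>.<S>.…` by design (cf. lakefile `weak.linter.dupNamespace`).
set_option linter.dupNamespace false

namespace Summit.FinalStateConjecture.FinalStateConjecture.Cruxes.GapExhaustion.Sketch

open Literature.Geometry.Lorentzian
open Set Filter Topology
open scoped Manifold ContDiff Topology ENNReal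

/-! ## Readable form of the crux -/

/-- **Readable form of `GapExhaustion`.** The filed text, with its three inlined blocks folded into
the route-posited notions `Spacetime.CollarMargin` (hypothesis), `CauchyDevelopment.IsNearKerrLeaf`
and `VacuumCauchyDevelopment.NearKerrCollarCore` (conclusion); each notion is by construction the
verbatim block, so the equivalence is `Iff.rfl`. [folklore] -/
theorem GapExhaustion_iff :
    Theses.BartnikGapSettling.GapExhaustion ↔
      ∀ (X : Type) [TopologicalSpace X] [ChartedSpace E3 X] [IsManifold (𝓡 3) ∞ X] [T2Space X]
        [SecondCountableTopology X] [ConnectedSpace X], ∀ D ∈ admissibleVacuumData X,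
        ∀ 𝒟 : VacuumCauchyDevelopment D, 𝒟.IsMaximal →
          Summit.FinalStateConjecture.HasCompleteNullInfinity 𝒟.toCauchyDevelopment →
          𝒟.CollarMargin →
          ∃ (N₀ : ℕ) (m₀ χ : ℝ), 0 < m₀ ∧ χ < 1 ∧ ∀ k : ℕ, ∃ Λ : ℝ≥0∞, Λ < ⊤ ∧
            ∀ (δ : ℝ≥0∞) (γ : ℝ), 0 < δ → 0 < γ → ∀ K : Set 𝒟.carrier, IsCompact K →
              ∃ (N : ℕ) (M a : Fin N → ℝ) (S : Set 𝒟.carrier) (p : 𝒟.carrier)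
                (mo : Fin N → lorentzGroup × E4) (B : Fin N → ModelBackground)
                (Φ : ∀ i, (B i).domain → 𝒟.carrier),
                N ≤ N₀ ∧ (∀ i, m₀ ≤ M i ∧ M i ≤ m₀⁻¹ ∧ |a i| ≤ χ * M i) ∧
                  𝒟.toCauchyDevelopment.IsNearKerrLeaf k Λ N M a S ∧ p ∈ S ∧
                  Disjoint (𝒟.metric.causalFuture 𝒟.timeOrientation S)
                    (𝒟.metric.causalPast 𝒟.timeOrientation K) ∧
                  𝒟.NearKerrCollarCore k δ γ N M a S p mo B Φ :=
  Iff.rfl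

/-! ## The four stubs -/

/-- **Stub (A⁺): late collared leaves** (card A's compactness stub (A) in `∃`-form, plus the
`N = 0` drain). For every admissible MGHD with complete `𝓘⁺` and a collar margin there are a mass
window `m₀` and a margin `χ < 1` such that for every leaf regularity `k` some finite geometry bound
`Λ` works: for every collar order `k'`, closeness `δ > 0`, budget `ε > 0` and compact `K` there is
a `(Λ, k)`-near-Kerr leaf `S` beyond `J⁻(K)` with `N ≤ 1` thick collar charts (boosted Kerr star
charts on `{M < r ≤ 3M} × (−1,1)`, smooth open embeddings of the collar layer, `δ`-close in
`C^{k'}` to Kerr on the thick slab, slab image inside `S`), parameters in the window, a probe point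
`p ∈ S` lying in every collar, and — in the collar-free branch `N = 0` only — a cut Bondi energy of
the cone of `p` of size `≤ ε` (late points of a horizonless development radiate almost nothing:
the final Bondi mass of the `N = 0` sector vanishes). Λ-bounded late hyperboloidal leaves, collar
convergence (area law + red-shift), the barrier clause, and the no-soliton content of the `N = 0`
sector live here. -/
theorem stub_lateCollaredLeaves :
    ∀ (X : Type) [TopologicalSpace X] [ChartedSpace E3 X] [IsManifold (𝓡 3) ∞ X] [T2Space X]
      [SecondCountableTopology X] [ConnectedSpace X], ∀ D ∈ admissibleVacuumData X,
      ∀ 𝒟 : VacuumCauchyDevelopment D, 𝒟.IsMaximal →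
        Summit.FinalStateConjecture.HasCompleteNullInfinity 𝒟.toCauchyDevelopment →
        𝒟.CollarMargin →
        ∃ (m₀ χ : ℝ), 0 < m₀ ∧ χ < 1 ∧ ∀ k : ℕ, ∃ Λ : ℝ≥0∞, Λ < ⊤ ∧
          ∀ (k' : ℕ) (δ : ℝ≥0∞) (ε : ℝ), 0 < δ → 0 < ε → ∀ K : Set 𝒟.carrier, IsCompact K →
            ∃ (N : ℕ) (M a : Fin N → ℝ) (S : Set 𝒟.carrier) (p : 𝒟.carrier)
              (mo : Fin N → lorentzGroup × E4) (B : Fin N → ModelBackground)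
              (Φ : ∀ i, (B i).domain → 𝒟.carrier),
              N ≤ 1 ∧ (∀ i, m₀ ≤ M i ∧ M i ≤ m₀⁻¹ ∧ |a i| ≤ χ * M i) ∧
                𝒟.toCauchyDevelopment.IsNearKerrLeaf k Λ N M a S ∧ p ∈ S ∧
                Disjoint (𝒟.metric.causalFuture 𝒟.timeOrientation S)
                  (𝒟.metric.causalPast 𝒟.timeOrientation K) ∧
                (∀ i, B i = starBackground (mo i).1 (mo i).2 (M i) (a i)
                  (fun x => Kerr.radius (a i) (poincareInv (mo i).1 (mo i).2 x))) ∧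
                (∀ i, ContMDiffOn 𝓘(ℝ, E4) (𝓡 4) ∞ (Φ i)
                    {x | -1 < (B i).time x.1 ∧ (B i).time x.1 < 1 ∧
                      (B i).radius x.1 < 3 * M i + 1} ∧
                  IsOpenEmbedding
                    ({x | -1 < (B i).time x.1 ∧ (B i).time x.1 < 1 ∧
                        (B i).radius x.1 < 3 * M i + 1}.restrict (Φ i))) ∧
                (∀ i, 𝒟.toSpacetime.truncDeviationCk (B i) (Φ i) k' (3 * M i) 0 ≤ δ) ∧
                (∀ i, Φ i '' (B i).truncTimeSlab (3 * M i) 0 ⊆ S) ∧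
                (∀ i, p ∈ Φ i '' (B i).truncTimeSlab (3 * M i) 0) ∧
                (N = 0 → ∃ m : ℝ, 𝒟.toCauchyDevelopment.HasCutBondiMass {p} m ∧ m ≤ ε) := by
  sorry

/-- **Stub (F⁺): single-collar tightness — no dark remainder** (card A's far-cone tightness (F),
cut regularity (E) and Bondi mass loss, in `ε`–`δ` form). For every admissible MGHD with complete
`𝓘⁺` and a collar margin, every window `m₀ > 0`, margin `χ < 1` and `ε > 0`, there are an order
`k'`, a closeness `δ > 0` and a compact `K₀` such that every thick collar chart with parameters in
the window, `δ`-close in `C^{k'}` to Kerr`(M, a)` on the thick slab `{t* = 0, M < r ≤ 3M}` and with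
slab image beyond `J⁻(K₀)`, has SOME cut Bondi energy `m ≤ M + ε` of the cone of its thick slab:
all the Bondi mass at the collar's retarded time is collar (Kerr) mass up to `ε` — late incoming
radiation is backscatter, far-zone field energy of the single hole is already counted, nothing is
parked outside `r = 3M`. (False as soon as a second compact object crosses the far cone: the
`N ≥ 2` sector of rattack D1/D2 is located exactly here.) -/
theorem stub_singleCollarTightness :
    ∀ (X : Type) [TopologicalSpace X] [ChartedSpace E3 X] [IsManifold (𝓡 3) ∞ X] [T2Space X]
      [SecondCountableTopology X] [ConnectedSpace X], ∀ D ∈ admissibleVacuumData X,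
      ∀ 𝒟 : VacuumCauchyDevelopment D, 𝒟.IsMaximal →
        Summit.FinalStateConjecture.HasCompleteNullInfinity 𝒟.toCauchyDevelopment →
        𝒟.CollarMargin →
        ∀ (m₀ χ ε : ℝ), 0 < m₀ → χ < 1 → 0 < ε →
          ∃ (k' : ℕ) (δ : ℝ≥0∞) (K₀ : Set 𝒟.carrier), 0 < δ ∧ IsCompact K₀ ∧
            ∀ (M a : ℝ) (mo : lorentzGroup × E4) (B : ModelBackground)
              (Φ : B.domain → 𝒟.carrier),
              m₀ ≤ M → M ≤ m₀⁻¹ → |a| ≤ χ * M →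
              B = starBackground mo.1 mo.2 M a (fun x => Kerr.radius a (poincareInv mo.1 mo.2 x)) →
              ContMDiffOn 𝓘(ℝ, E4) (𝓡 4) ∞ Φ
                {x | -1 < B.time x.1 ∧ B.time x.1 < 1 ∧ B.radius x.1 < 3 * M + 1} →
              IsOpenEmbedding
                ({x | -1 < B.time x.1 ∧ B.time x.1 < 1 ∧ B.radius x.1 < 3 * M + 1}.restrict Φ) →
              𝒟.toSpacetime.truncDeviationCk B Φ k' (3 * M) 0 ≤ δ →
              Disjoint (Φ '' B.truncTimeSlab (3 * M) 0)
                (𝒟.metric.causalPast 𝒟.timeOrientation K₀) →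
              ∃ m : ℝ, 𝒟.toCauchyDevelopment.HasCutBondiMass (Φ '' B.truncTimeSlab (3 * M) 0) m ∧
                m ≤ M + ε := by
  sorry

/-- **Stub (K): quantitative Kerr-collar minimality** (route-review O1's KCM; verbatim the
ideator's `KerrCollarMinimalityQuant`, shared with crux `BondiBartnikRigidity`'s calibration stub).
For every margin `χ < 1`, window `m₀ > 0` and `ε > 0` there are `k, δ > 0` such that in every MGHD
of admissible data every competitor mass (`IsCompetitorMass`: a cut Bondi energy of the image of
the core in an MGHD of admissible data receiving an isometric, time-oriented open embedding of a
neighbourhood of it) of the thick collar `Φ({t* = 0, M < r ≤ 3M})` of a Kerr-star chart `δ`-close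
in `Cᵏ` to Kerr`(M, a)`, `m₀ ≤ M ≤ 1/m₀`, `|a| ≤ χM`, is at least `M − ε`. A Bondi/null Penrose-type
inequality with angular momentum together with the rigidity of its equality case; open even at
`a = 0` beyond perturbations of Schwarzschild cones (arXiv:1506.06400). -/
theorem stub_kerrCollarMinimality :
    ∀ (χ m₀ ε : ℝ), χ < 1 → 0 < m₀ → 0 < ε → ∃ (k : ℕ) (δ : ℝ≥0∞), 0 < δ ∧
      ∀ (X : Type) [TopologicalSpace X] [ChartedSpace E3 X] [IsManifold (𝓡 3) ∞ X] [T2Space X]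
        [SecondCountableTopology X] [ConnectedSpace X], ∀ D ∈ admissibleVacuumData X,
        ∀ (𝒟 : VacuumCauchyDevelopment D) (M a : ℝ) (mo : lorentzGroup × E4) (B : ModelBackground)
          (Φ : B.domain → 𝒟.carrier), 𝒟.IsMaximal → m₀ ≤ M → M ≤ m₀⁻¹ → |a| ≤ χ * M →
          B = starBackground mo.1 mo.2 M a (fun x => Kerr.radius a (poincareInv mo.1 mo.2 x)) →
          ContMDiffOn 𝓘(ℝ, E4) (𝓡 4) ∞ Φ
            {x | -1 < B.time x.1 ∧ B.time x.1 < 1 ∧ B.radius x.1 < 3 * M + 1} →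
          IsOpenEmbedding
            ({x | -1 < B.time x.1 ∧ B.time x.1 < 1 ∧ B.radius x.1 < 3 * M + 1}.restrict Φ) →
          𝒟.toSpacetime.truncDeviationCk B Φ k (3 * M) 0 ≤ δ →
          ∀ m' : ℝ, 𝒟.IsCompetitorMass (Φ '' B.truncTimeSlab (3 * M) 0) m' → M - ε ≤ m' := by
  sorry

/-- **Stub (P): point-cone Bondi energies are nonnegative.** In a maximal vacuum Cauchy
development of admissible data (complete, one-ended, asymptotically flat vacuum data), every cut
Bondi energy of the light cone of a point — a limit of Hawking masses along an asymptotically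
round receding family of sections of `∂J⁺({q})` — is `≥ 0`: positivity of the Bondi energy
(Schoen–Yau 1982, Ludvigsen–Vickers 1982, Horowitz–Perry 1982) in the intrinsic round-family
vocabulary of `CutBondiMass` (energy in any asymptotic frame `≥` rest mass `≥ 0`). -/
theorem stub_pointConeEnergyNonneg :
    ∀ (X : Type) [TopologicalSpace X] [ChartedSpace E3 X] [IsManifold (𝓡 3) ∞ X] [T2Space X]
      [SecondCountableTopology X] [ConnectedSpace X], ∀ D ∈ admissibleVacuumData X,
      ∀ 𝒟 : VacuumCauchyDevelopment D, 𝒟.IsMaximal →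
        ∀ (q : 𝒟.carrier) (m : ℝ), 𝒟.toCauchyDevelopment.HasCutBondiMass {q} m → 0 ≤ m := by
  sorry

/-! ## Soft lemmas of the composition -/

/-- Competitor masses of a singleton core are point-cone energies of the competitor, hence `≥ 0`
by stub (P). [folklore] -/
theorem isCompetitorMass_singleton_nonneg {X : Type} [TopologicalSpace X] [ChartedSpace E3 X]
    [IsManifold (𝓡 3) ∞ X] [ConnectedSpace X] {D : InitialDataSet (𝓡 3) X}
    {𝒟 : VacuumCauchyDevelopment D} {p : 𝒟.carrier} {m' : ℝ}
    (h : 𝒟.IsCompetitorMass {p} m') : 0 ≤ m' := by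
  obtain ⟨X', _, _, _, _, _, _, D', 𝒟', U, φ, hc, hm'⟩ := h
  rw [image_singleton] at hm'
  exact stub_pointConeEnergyNonneg X' D' hc.mem_admissibleVacuumData 𝒟' hc.isMaximal (φ p) m' hm'

/-- With the probe point inside the single collar, the core `{p} ∪ collar` is the collar.
[folklore] -/
theorem collarCore_fin_one {α : Type} (M : Fin 1 → ℝ) (p : α) (B : Fin 1 → ModelBackground)
    (Φ : ∀ i, (B i).domain → α) (hp : p ∈ Φ 0 '' (B 0).truncTimeSlab (3 * M 0) 0) :
    collarCore M p B Φ = Φ 0 '' (B 0).truncTimeSlab (3 * M 0) 0 := by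
  have hU : (⋃ i : Fin 1, Φ i '' (B i).truncTimeSlab (3 * M i) 0) =
      Φ 0 '' (B 0).truncTimeSlab (3 * M 0) 0 := by
    ext q
    simp only [mem_iUnion, Fin.exists_fin_one]
  rw [collarCore, hU, union_eq_right]
  exact singleton_subset_iff.2 hp

/-! ## Composition -/

/-- **Composition.** `GapExhaustion` from the four stubs: `N₀ = 1`; `(m₀, χ, Λ(k))` from stub (A⁺);
given `(δ, γ, K)`, the orders of stubs (F⁺) and (K) (at budget `γ/2`) are combined by `max` before
their tolerances by `min` and their compact sets by `∪`; closeness is transported down in the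
order and up in the size (`supCkENorm_mono_right`); pairwise disjointness of `≤ 1` collars is
trivial; the gap clause is `bondiBartnikGapLE_of_forall_le` with own energy `≤ Σ M + γ/2` and
competitor masses `≥ Σ M − γ/2` (stub (K) for `N = 1`, stub (P) for `N = 0`). [folklore] -/
theorem GapExhaustion_of : Theses.BartnikGapSettling.GapExhaustion := by
  rw [GapExhaustion_iff]
  intro X _ _ _ _ _ _ D hD 𝒟 hmax hcni hcm
  obtain ⟨m₀, χ, hm₀, hχ, hA⟩ := stub_lateCollaredLeaves X D hD 𝒟 hmax hcni hcm
  refine ⟨1, m₀, χ, hm₀, hχ, fun k => ?_⟩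
  obtain ⟨Λ, hΛ, hA⟩ := hA k
  refine ⟨Λ, hΛ, fun δ γ hδ hγ K hK => ?_⟩
  have hγ2 : 0 < γ / 2 := by positivity
  -- orders and tolerances of the two calibrating stubs, at budget γ/2
  obtain ⟨kF, δF, K₀, hδF, hK₀, hF⟩ :=
    stub_singleCollarTightness X D hD 𝒟 hmax hcni hcm m₀ χ (γ / 2) hm₀ hχ hγ2
  obtain ⟨kK, δK, hδK, hKCM⟩ := stub_kerrCollarMinimality χ m₀ (γ / 2) hχ hm₀ hγ2
  -- one late configuration from stub (A⁺)
  obtain ⟨N, M, a, S, p, mo, B, Φ, hN, hwin, hleaf, hp, hlate, hB, hΦ, hdev, hS, hpΦ, hN0⟩ :=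
    hA (max k (max kF kK)) (min δ (min δF δK)) (γ / 2) (lt_min hδ (lt_min hδF hδK)) hγ2
      (K ∪ K₀) (hK.union hK₀)
  have hlateK : Disjoint (𝒟.metric.causalFuture 𝒟.timeOrientation S)
      (𝒟.metric.causalPast 𝒟.timeOrientation K) :=
    hlate.mono_right (LorentzianMetric.causalFuture_mono subset_union_left)
  have hlateK₀ : Disjoint (𝒟.metric.causalFuture 𝒟.timeOrientation S)
      (𝒟.metric.causalPast 𝒟.timeOrientation K₀) :=
    hlate.mono_right (LorentzianMetric.causalFuture_mono subset_union_right)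
  -- closeness transported to the three orders / sizes
  have hdev_k : ∀ i, 𝒟.toSpacetime.truncDeviationCk (B i) (Φ i) k (3 * M i) 0 ≤ δ := fun i =>
    ((supCkENorm_mono_right _ (le_max_left _ _) _).trans (hdev i)).trans (min_le_left _ _)
  have hdev_F : ∀ i, 𝒟.toSpacetime.truncDeviationCk (B i) (Φ i) kF (3 * M i) 0 ≤ δF := fun i =>
    ((supCkENorm_mono_right _ ((le_max_left _ _).trans (le_max_right _ _)) _).trans
      (hdev i)).trans ((min_le_right _ _).trans (min_le_left _ _))
  have hdev_K : ∀ i, 𝒟.toSpacetime.truncDeviationCk (B i) (Φ i) kK (3 * M i) 0 ≤ δK := fun i =>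
    ((supCkENorm_mono_right _ ((le_max_right _ _).trans (le_max_right _ _)) _).trans
      (hdev i)).trans ((min_le_right _ _).trans (min_le_right _ _))
  refine ⟨N, M, a, S, p, mo, B, Φ, hN, hwin, hleaf, hp, hlateK, hB, hΦ, hdev_k, hS, ?_, ?_⟩
  · -- (C5): at most one collar
    have : Subsingleton (Fin N) := by
      rcases Nat.le_one_iff_eq_zero_or_eq_one.1 hN with rfl | rfl <;> infer_instance
    exact Subsingleton.pairwise
  · -- (C6) + (C7): the two scalar bounds, by cases on N
    rcases Nat.le_one_iff_eq_zero_or_eq_one.1 hN with rfl | rfl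
    · -- N = 0: core = {p}
      obtain ⟨m, hm, hmε⟩ := hN0 rfl
      have hcore : collarCore M p B Φ = {p} := collarCore_of_isEmpty M p B Φ
      have hgap : 𝒟.BondiBartnikGapLE (collarCore M p B Φ) γ := by
        rw [hcore]
        refine VacuumCauchyDevelopment.bondiBartnikGapLE_of_forall_le hm fun m' hm' => ?_
        have h0 : 0 ≤ m' := isCompetitorMass_singleton_nonneg hm'
        linarith
      refine ⟨⟨m, ?_⟩, hgap⟩
      change 𝒟.toCauchyDevelopment.HasCutBondiMass (collarCore M p B Φ) m
      rw [hcore]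
      exact hm
    · -- N = 1: core = the thick collar
      have hcore : collarCore M p B Φ = Φ 0 '' (B 0).truncTimeSlab (3 * M 0) 0 :=
        collarCore_fin_one M p B Φ (hpΦ 0)
      have hcol_late : Disjoint (Φ 0 '' (B 0).truncTimeSlab (3 * M 0) 0)
          (𝒟.metric.causalPast 𝒟.timeOrientation K₀) :=
        hlateK₀.mono_left ((hS 0).trans (LorentzianMetric.subset_causalFuture _ _ _))
      obtain ⟨m, hm, hmε⟩ := hF (M 0) (a 0) (mo 0) (B 0) (Φ 0) (hwin 0).1 (hwin 0).2.1
        (hwin 0).2.2 (hB 0) (hΦ 0).1 (hΦ 0).2 (hdev_F 0) hcol_late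
      have hgap : 𝒟.BondiBartnikGapLE (collarCore M p B Φ) γ := by
        rw [hcore]
        refine VacuumCauchyDevelopment.bondiBartnikGapLE_of_forall_le hm fun m' hm' => ?_
        have hlow : M 0 - γ / 2 ≤ m' :=
          hKCM X D hD 𝒟 (M 0) (a 0) (mo 0) (B 0) (Φ 0) hmax (hwin 0).1 (hwin 0).2.1 (hwin 0).2.2
            (hB 0) (hΦ 0).1 (hΦ 0).2 (hdev_K 0) m' hm'
        linarith
      refine ⟨⟨m, ?_⟩, hgap⟩
      change 𝒟.toCauchyDevelopment.HasCutBondiMass (collarCore M p B Φ) m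
      rw [hcore]
      exact hm

end Summit.FinalStateConjecture.FinalStateConjecture.Cruxes.GapExhaustion.Sketch

end
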